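import Literature.NumberTheory.Sieve.QuadraticRootsPrimeModuliDFIReduction
import Literature.NumberTheory.Sieve.PolynomialCongruencesMeanValues
import HarnessLib

/-!
# Duke–Friedlander–Iwaniec 1995, §5: sums of the root-counting function `ρ` (the "trivial" bounds)

Topic `Literature/NumberTheory/Sieve`.  Fourth file of the deduction of DFI's Propositions 1–2 from
Proposition 4 (W. Duke, J. B. Friedlander, H. Iwaniec, Ann. of Math. 141 (1995), §5 p. 433).
In §5 two estimates are "trivial": the diagonal `B_{nn}(M) ≪ M`, which needs
`∑_{m ≤ X} ρ(m) ≪ X`, and the removal of the condition `(m, n₁n₂) = 1` "at the cost of two error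
terms bounded trivially by `4 ∑_{m ≡ 0 (n_j)} g(m) ρ(m) ≪ N^{−1} M` … taking advantage of the fact
that `n₁, n₂` are primes", which needs `∑_{m ≤ X, p ∣ m} ρ(p q m) ≪ X/p` uniformly in the primes
`p ≠ q`.  For DFI's quadratics `f = aX² + 2bX + c`, `ac − b² > 0` — which need NOT be primitive,
so that the tree's results for irreducible polynomials are applied to the primitive part `f₀` and
transferred by `ρ_f(n) ≤ (n, cont f) ρ_{f₀}(n/(n, cont f))` — this file PROVES
(`ρ = ρ_f = polyRootCountMod ![f]`):

* `DFI1995.exists_primPart_quad` — `f₀` irreducible of degree `2` and the transfer inequality;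
* `DFI1995.exists_rho_primePow_le_quad` — `ρ(p^a) ≤ B_f` for all prime powers (Hooley's
  Lemma 4 / Nagell for `f₀`, the tree's `exists_rootCount_primePow_le`);
* `DFI1995.exists_sum_rho_le_quad` — `∑_{m ≤ Y} ρ(m) ≤ C_f Y` for all `Y ≥ 0` (the tree's
  `exists_sum_rootCount_le` for `f₀`);
* `DFI1995.sum_rho_primePow_mul_le` — for any `f`: if `ρ(p^a) ≤ B` on prime powers and
  `∑_{m ≤ Y} ρ(km) ≤ C Y` (`p ∤ k`), then `∑_{m ≤ X} ρ(p^a k m) ≤ 2BC X` for every `a ≥ 1`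
  (peel off the `p`-part: `ρ(p^a k m) = ρ(p^{a+j}) ρ(k m')` for `m = p^j m'`, `p ∤ m'`);
* `DFI1995.exists_sum_rho_offdiag_le_quad` — `∑_{m ≤ X, p ∣ m} ρ(p q m) ≤ C_f X / p` for primes
  `p ≠ q` [cite: DukeFriedlanderIwaniec1995, §5 p. 433 (the error terms `≪ N^{−1}M`)].

## References

* W. Duke, J. B. Friedlander, H. Iwaniec, Ann. of Math. (2) 141 (1995), 423–441, §5 p. 433.
  [cite: DukeFriedlanderIwaniec1995, §5 p. 433]
* C. Hooley, Acta Math. 110 (1964), Lemma 4 (`ρ_f(k) ≤ C n^{ω(k)}`; the tree's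
  `exists_rootCount_primePow_le`, `exists_sum_rootCount_le`). [cite: Hooley1964, Lemma 4]
-/

noncomputable section

namespace Literature.NumberTheory.Sieve

open scoped BigOperators Polynomial
open Finset Polynomial

namespace DFI1995

/-! ### Reindexing multiples -/

/-- `∑_{1 ≤ n ≤ X, d ∣ n} F(n) = ∑_{1 ≤ m ≤ X/d} F(dm)`. [folklore] -/
theorem sum_Icc_filter_dvd_eq {M : Type*} [AddCommMonoid M] {d : ℕ} (hd : 1 ≤ d) {X : ℝ}
    (hX : 0 ≤ X) (F : ℕ → M) :
    ∑ n ∈ (Icc 1 ⌊X⌋₊).filter (fun n : ℕ => d ∣ n), F n = ∑ m ∈ Icc 1 ⌊X / d⌋₊, F (d * m) := by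
  have hd0 : (0 : ℝ) < d := by exact_mod_cast hd
  refine Finset.sum_nbij' (fun n => n / d) (fun m => d * m) ?_ ?_ ?_ ?_ ?_
  · intro n hn
    simp only [Finset.mem_filter, Finset.mem_Icc] at hn
    obtain ⟨⟨h1, h2⟩, k, rfl⟩ := hn
    simp only [Finset.mem_Icc, Nat.mul_div_cancel_left _ (show 0 < d by omega)]
    constructor
    · rcases Nat.eq_zero_or_pos k with rfl | hk
      · simp at h1
      · exact hk
    · rw [Nat.le_floor_iff (by positivity), le_div_iff₀ hd0]
      rw [Nat.le_floor_iff hX] at h2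
      push_cast at h2
      linarith
  · intro m hm
    simp only [Finset.mem_Icc] at hm
    simp only [Finset.mem_filter, Finset.mem_Icc]
    refine ⟨⟨?_, ?_⟩, dvd_mul_right _ _⟩
    · calc 1 ≤ d * 1 := by omega
        _ ≤ d * m := Nat.mul_le_mul_left _ hm.1
    · rw [Nat.le_floor_iff hX]
      have h2 := hm.2
      rw [Nat.le_floor_iff (by positivity), le_div_iff₀ hd0] at h2
      push_cast
      linarith
  · intro n hn
    simp only [Finset.mem_filter] at hn
    exact Nat.mul_div_cancel' hn.2
  · intro m _
    exact Nat.mul_div_cancel_left _ (by omega)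
  · intro n hn
    simp only [Finset.mem_filter] at hn
    rw [Nat.mul_div_cancel' hn.2]

/-! ### Peeling off one prime: `∑_{m ≤ X} ρ(p^a k m) ≤ 2BC X` -/

/-- **Peeling a prime off a `ρ`-sum.**  Let `f ∈ ℤ[X]`, `ρ = ρ_f`.  Suppose `ρ(q^b) ≤ B` for all
prime powers, and for some `k` with `p ∤ k`, `∑_{1 ≤ m ≤ Y} ρ(km) ≤ C Y` for all `Y ≥ 0`.  Then for
every `a ≥ 1` and `X ≥ 0`, `∑_{1 ≤ m ≤ X} ρ(p^a k m) ≤ 2BC X`: splitting `m` according to `p ∤ m`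
(`ρ(p^a km) = ρ(p^a) ρ(km) ≤ B ρ(km)`, multiplicativity) or `m = p m'` (induction at `X/p ≤ X/2`).
[folklore] -/
theorem sum_rho_primePow_mul_le {f : ℤ[X]} {B C : ℝ}
    (hB : ∀ q b : ℕ, q.Prime → (polyRootCountMod ![f] (q ^ b) : ℝ) ≤ B) (hC : 0 ≤ C)
    {p k : ℕ} (hp : p.Prime) (hpk : ¬ p ∣ k)
    (hk : ∀ Y : ℝ, 0 ≤ Y → ∑ m ∈ Icc 1 ⌊Y⌋₊, (polyRootCountMod ![f] (k * m) : ℝ) ≤ C * Y) :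
    ∀ a : ℕ, 1 ≤ a → ∀ X : ℝ, 0 ≤ X →
      ∑ m ∈ Icc 1 ⌊X⌋₊, (polyRootCountMod ![f] (p ^ a * k * m) : ℝ) ≤ 2 * B * C * X := by
  have hB1 : 1 ≤ B := by
    have := hB 2 0 Nat.prime_two
    rw [pow_zero, polyRootCountMod_single] at this
    simpa using this
  have hp2 : (2 : ℝ) ≤ p := by exact_mod_cast hp.two_le
  -- strong induction on `⌊X⌋₊`
  suffices H : ∀ n : ℕ, ∀ a : ℕ, 1 ≤ a → ∀ X : ℝ, 0 ≤ X → ⌊X⌋₊ = n →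
      ∑ m ∈ Icc 1 ⌊X⌋₊, (polyRootCountMod ![f] (p ^ a * k * m) : ℝ) ≤ 2 * B * C * X from
    fun a ha X hX => H _ a ha X hX rfl
  intro n
  induction n using Nat.strong_induction_on with
  | _ n ih =>
    intro a ha X hX hn
    -- split according to `p ∣ m`
    rw [← Finset.sum_filter_add_sum_filter_not (Icc 1 ⌊X⌋₊) (fun m : ℕ => p ∣ m)]
    -- the part `p ∤ m`
    have h1 : ∑ m ∈ (Icc 1 ⌊X⌋₊).filter (fun m : ℕ => ¬ p ∣ m),
        (polyRootCountMod ![f] (p ^ a * k * m) : ℝ) ≤ B * C * X := by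
      calc ∑ m ∈ (Icc 1 ⌊X⌋₊).filter (fun m : ℕ => ¬ p ∣ m), (polyRootCountMod ![f] (p ^ a * k * m) : ℝ)
          ≤ ∑ m ∈ (Icc 1 ⌊X⌋₊).filter (fun m : ℕ => ¬ p ∣ m), B * (polyRootCountMod ![f] (k * m) : ℝ) := by
            refine Finset.sum_le_sum fun m hm => ?_
            rw [Finset.mem_filter] at hm
            have hcop : (p ^ a).Coprime (k * m) := by
              apply Nat.Coprime.pow_left
              rw [Nat.Prime.coprime_iff_not_dvd hp]
              intro hdvd
              rcases (Nat.Prime.dvd_mul hp).1 hdvd with h | h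
              · exact hpk h
              · exact hm.2 h
            rw [mul_assoc, polyRootCountMod_mul_of_coprime f hcop]
            push_cast
            exact mul_le_mul_of_nonneg_right (hB p a hp) (Nat.cast_nonneg _)
        _ = B * ∑ m ∈ (Icc 1 ⌊X⌋₊).filter (fun m : ℕ => ¬ p ∣ m), (polyRootCountMod ![f] (k * m) : ℝ) := by
            rw [Finset.mul_sum]
        _ ≤ B * ∑ m ∈ Icc 1 ⌊X⌋₊, (polyRootCountMod ![f] (k * m) : ℝ) := by
            refine mul_le_mul_of_nonneg_left ?_ (by linarith)
            exact Finset.sum_le_sum_of_subset_of_nonneg (Finset.filter_subset _ _)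
              fun _ _ _ => Nat.cast_nonneg _
        _ ≤ B * (C * X) := mul_le_mul_of_nonneg_left (hk X hX) (by linarith)
        _ = B * C * X := by ring
    -- the part `p ∣ m`: `m = p m'`, `m' ≤ X/p`
    have h2 : ∑ m ∈ (Icc 1 ⌊X⌋₊).filter (fun m : ℕ => p ∣ m),
        (polyRootCountMod ![f] (p ^ a * k * m) : ℝ) ≤ B * C * X := by
      rw [sum_Icc_filter_dvd_eq hp.one_lt.le hX]
      have hresc : ∀ m : ℕ, p ^ a * k * (p * m) = p ^ (a + 1) * k * m := fun m => by ring
      simp_rw [hresc]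
      rcases Nat.eq_zero_or_pos n with rfl | hnpos
      · -- `X < 1`: also `X/p < 1`, the sum is empty
        have hXp : ⌊X / p⌋₊ = 0 := by
          rw [Nat.floor_eq_zero]
          have : X < 1 := by
            have := (Nat.floor_eq_zero.1 hn)
            exact this
          calc X / p ≤ X / 1 := by
                apply div_le_div_of_nonneg_left hX one_pos; linarith
            _ < 1 := by rw [div_one]; exact this
        rw [hXp]
        simp only [show Icc 1 0 = ∅ by rfl, Finset.sum_empty]
        positivity
      · have hlt : ⌊X / p⌋₊ < n := by
          rw [Nat.floor_div_natCast, ← hn]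
          exact Nat.div_lt_self (by omega) hp.one_lt
        have := ih _ hlt (a + 1) (by omega) (X / p) (by positivity) rfl
        calc ∑ m ∈ Icc 1 ⌊X / p⌋₊, (polyRootCountMod ![f] (p ^ (a + 1) * k * m) : ℝ)
            ≤ 2 * B * C * (X / p) := this
          _ ≤ 2 * B * C * (X / 2) := by
              gcongr
          _ = B * C * X := by ring
    linarith

/-! ### DFI's quadratics: primitive part, prime powers, mean value -/

/-- **The primitive part of a DFI quadratic.**  For `f = aX² + 2bX + c` with `ac − b² > 0` there
are `f₀ ∈ ℤ[X]` irreducible of degree `2` and `g ≥ 1` (`f = ±g f₀`, `g = |cont f|`) such that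
`ρ_f(n) ≤ (n, g) ρ_{f₀}(n/(n, g))` for all `n ≥ 1` (a root of `f` modulo `n` is a root of `f₀`
modulo `n/(n,g)`, an `n/(n,g)`-periodic condition). [folklore] -/
theorem exists_primPart_quad {a b c : ℤ} (hD : 0 < a * c - b ^ 2) :
    ∃ (f₀ : ℤ[X]) (g : ℕ), 1 ≤ g ∧ Irreducible f₀ ∧ f₀.natDegree = 2 ∧
      ∀ n : ℕ, 1 ≤ n →
        polyRootCountMod ![quad a b c] n ≤ Nat.gcd n g * polyRootCountMod ![f₀] (n / Nat.gcd n g) := by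
  have ha : a ≠ 0 := by
    rintro rfl
    nlinarith [sq_nonneg b]
  set F : ℤ[X] := quad a b c with hFdef
  have hFdeg : F.natDegree = 2 := by
    rw [hFdef, quad]; exact natDegree_quadratic ha
  have hF0 : F ≠ 0 := by
    rintro hF
    rw [hF, natDegree_zero] at hFdeg
    exact absurd hFdeg (by norm_num)
  have hcont : F.content ≠ 0 := mt content_eq_zero_iff.mp hF0
  set F₀ : ℤ[X] := F.primPart with hF₀def
  have hFF₀ : F = C F.content * F₀ := F.eq_C_content_mul_primPart
  have hF₀deg : F₀.natDegree = 2 := by rw [hF₀def, natDegree_primPart, hFdeg]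
  have hF₀prim : F₀.IsPrimitive := isPrimitive_primPart F
  -- `F₀` is irreducible: over `ℚ`, `F` (hence the unit multiple `F₀`) has degree 2 and no root.
  have hFeval : ∀ x : ℚ, (F.map (algebraMap ℤ ℚ)).eval x = a * x ^ 2 + 2 * b * x + c := by
    intro x
    simp only [hFdef, quad, Polynomial.map_add, Polynomial.map_mul, Polynomial.map_pow,
      map_X, Polynomial.map_C, eval_add, eval_mul, eval_C, eval_pow, eval_X]
    simp only [eq_intCast]
    push_cast
    ring
  have hFQdeg : (F.map (algebraMap ℤ ℚ)).natDegree = 2 := by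
    rw [natDegree_map_eq_of_injective (algebraMap ℤ ℚ).injective_int, hFdeg]
  have hnoroot : ∀ x : ℚ, ¬ (F.map (algebraMap ℤ ℚ)).IsRoot x := by
    intro x hx
    rw [IsRoot, hFeval] at hx
    have hdisc : ∀ s : ℚ, discrim (a : ℚ) (2 * b) c ≠ s ^ 2 := by
      intro s hs
      have hD' : ((0 : ℤ) : ℚ) < ((a * c - b ^ 2 : ℤ) : ℚ) := by exact_mod_cast hD
      push_cast at hD'
      unfold discrim at hs
      nlinarith [sq_nonneg s]
    exact quadratic_ne_zero_of_discrim_ne_sq hdisc x (by linear_combination hx)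
  have hirrFQ : Irreducible (F.map (algebraMap ℤ ℚ)) :=
    irreducible_of_degree_le_three_of_not_isRoot (by rw [hFQdeg]; decide) hnoroot
  have hirrF₀Q : Irreducible (F₀.map (algebraMap ℤ ℚ)) := by
    have hmap : F.map (algebraMap ℤ ℚ) =
        C (algebraMap ℤ ℚ F.content) * F₀.map (algebraMap ℤ ℚ) := by
      conv_lhs => rw [hFF₀]
      rw [Polynomial.map_mul, map_C]
    rw [hmap] at hirrFQ
    exact (irreducible_isUnit_mul (isUnit_C.mpr (IsUnit.mk0 _
      ((map_ne_zero_iff _ (algebraMap ℤ ℚ).injective_int).mpr hcont)))).1 hirrFQ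
  have hirrF₀ : Irreducible F₀ :=
    (IsPrimitive.irreducible_iff_irreducible_map_fraction_map hF₀prim).2 hirrF₀Q
  set g : ℕ := F.content.natAbs with hgdef
  have hg0 : g ≠ 0 := Int.natAbs_ne_zero.mpr hcont
  refine ⟨F₀, g, Nat.one_le_iff_ne_zero.2 hg0, hirrF₀, hF₀deg, fun n hn => ?_⟩
  have hgc : (g : ℤ) = F.content := by
    rw [hgdef, Int.natCast_natAbs, Int.abs_eq_normalize, normalize_content]
  set d : ℕ := Nat.gcd n g with hddef
  have hd0 : 0 < d := Nat.gcd_pos_of_pos_left _ (by omega)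
  set n₁ : ℕ := n / d with hn₁def
  have hdn₁ : d * n₁ = n := Nat.mul_div_cancel' (Nat.gcd_dvd_left n g)
  -- `ρ_F(n) = #{ν < n : n ∣ F(ν)} ≤ #{ν < n : n₁ ∣ F₀(ν)} = d ρ_{F₀}(n₁)`
  rw [← card_filter_dvd_eval_eq_polyRootCountMod]
  have h2 : ((Finset.range n).filter (fun ν : ℕ => (n : ℤ) ∣ F.eval (ν : ℤ))).card ≤
      ((Finset.range n).filter (fun ν : ℕ => (n₁ : ℤ) ∣ F₀.eval (ν : ℤ))).card := by
    refine Finset.card_le_card fun ν hν => ?_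
    rw [Finset.mem_filter] at hν ⊢
    refine ⟨hν.1, ?_⟩
    have hev : F.eval (ν : ℤ) = (g : ℤ) * F₀.eval (ν : ℤ) := by
      conv_lhs => rw [hFF₀]
      rw [eval_mul, eval_C, hgc]
    have := hν.2
    rw [hev] at this
    exact div_gcd_dvd_of_dvd_mul hg0 this
  have h3 : ((Finset.range n).filter (fun ν : ℕ => (n₁ : ℤ) ∣ F₀.eval (ν : ℤ))).card =
      d * polyRootCountMod ![F₀] n₁ := by
    rw [← card_filter_dvd_eval_eq_polyRootCountMod, ← card_filter_range_mul_dvd_eval, hdn₁]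
  exact h2.trans h3.le

/-- A divisor of a prime power is a prime power. [folklore] -/
theorem div_gcd_prime_pow_eq {p : ℕ} (hp : p.Prime) (a g : ℕ) :
    ∃ j : ℕ, p ^ a / Nat.gcd (p ^ a) g = p ^ j := by
  have hdvd : p ^ a / Nat.gcd (p ^ a) g ∣ p ^ a := Nat.div_dvd_of_dvd (Nat.gcd_dvd_left _ _)
  obtain ⟨j, -, hj⟩ := (Nat.dvd_prime_pow hp).1 hdvd
  exact ⟨j, hj⟩

/-- **`ρ_f(p^a) ≤ B_f` on prime powers** for DFI's quadratics (via the primitive part and the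
tree's `exists_rootCount_primePow_le` = Hooley's Lemma 4 / Nagell). [cite: Hooley1964, Lemma 4] -/
theorem exists_rho_primePow_le_quad {a b c : ℤ} (hD : 0 < a * c - b ^ 2) :
    ∃ B : ℝ, 1 ≤ B ∧ ∀ p k : ℕ, p.Prime → (polyRootCountMod ![quad a b c] (p ^ k) : ℝ) ≤ B := by
  obtain ⟨f₀, g, hg, hirr, hdeg, htrans⟩ := exists_primPart_quad hD
  obtain ⟨M, hM1, hM, -⟩ := exists_rootCount_primePow_le hirr (by rw [hdeg]; norm_num)
  refine ⟨(g : ℝ) * (2 * M), ?_, fun p k hp => ?_⟩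
  · have : (1 : ℝ) ≤ g := by exact_mod_cast hg
    have : (1 : ℝ) ≤ M := by exact_mod_cast hM1
    nlinarith
  have h1 := htrans (p ^ k) (Nat.one_le_pow _ _ hp.pos)
  obtain ⟨j, hj⟩ := div_gcd_prime_pow_eq hp k g
  rw [hj] at h1
  have h2 := hM p hp j
  rw [hdeg] at h2
  have hgcd : Nat.gcd (p ^ k) g ≤ g := Nat.gcd_le_right _ (by omega)
  calc (polyRootCountMod ![quad a b c] (p ^ k) : ℝ)
      ≤ ((Nat.gcd (p ^ k) g * polyRootCountMod ![f₀] (p ^ j) : ℕ) : ℝ) := by exact_mod_cast h1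
    _ ≤ ((g * (2 * M) : ℕ) : ℝ) := by exact_mod_cast Nat.mul_le_mul hgcd h2
    _ = (g : ℝ) * (2 * M) := by push_cast; ring

/-- **Mean value `∑_{m ≤ Y} ρ_f(m) ≤ C_f Y`** (`Y ≥ 0`) for DFI's quadratics: from the tree's
`exists_sum_rootCount_le` for the primitive part `f₀` and
`ρ_f(m) ≤ g ρ_{f₀}(m/(m,g)) ≤ g ∑_{e ∣ g, e ∣ m} ρ_{f₀}(m/e)`. [folklore] -/
theorem exists_sum_rho_le_quad {a b c : ℤ} (hD : 0 < a * c - b ^ 2) :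
    ∃ C : ℝ, 0 < C ∧ ∀ Y : ℝ, 0 ≤ Y →
      ∑ m ∈ Icc 1 ⌊Y⌋₊, (polyRootCountMod ![quad a b c] m : ℝ) ≤ C * Y := by
  obtain ⟨f₀, g, hg, hirr, hdeg, htrans⟩ := exists_primPart_quad hD
  obtain ⟨C₀, hC₀, hmv⟩ := exists_sum_rootCount_le hirr (by rw [hdeg]; norm_num)
  -- `∑_{m' ≤ y} ρ_{f₀}(m') ≤ (C₀ + 1) y` for `y ≥ 1` and the sum vanishes for `y < 1`
  have hmv' : ∀ y : ℝ, 1 ≤ y → ∑ m ∈ Icc 1 ⌊y⌋₊, (polyRootCountMod ![f₀] m : ℝ) ≤ (C₀ + 1) * y := by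
    intro y hy
    rcases le_or_gt 2 y with h2 | h2
    · calc ∑ m ∈ Icc 1 ⌊y⌋₊, (polyRootCountMod ![f₀] m : ℝ) ≤ C₀ * y := hmv y h2
        _ ≤ (C₀ + 1) * y := by nlinarith
    · have hfl : ⌊y⌋₊ = 1 := by
        rw [Nat.floor_eq_iff (by linarith)]
        constructor <;> push_cast <;> linarith
      rw [hfl, Finset.Icc_self, Finset.sum_singleton]
      have h1 : (polyRootCountMod ![f₀] 1 : ℝ) ≤ 1 := by exact_mod_cast polyRootCountMod_le ![f₀] 1
      nlinarith
  refine ⟨(g : ℝ) * ((g : ℝ) * (C₀ + 1)) + 1, by positivity, fun Y hY => ?_⟩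
  rcases lt_or_ge Y 1 with hY1 | hY1
  · have : ⌊Y⌋₊ = 0 := Nat.floor_eq_zero.2 hY1
    rw [this]
    simp only [show Icc 1 0 = ∅ by rfl, Finset.sum_empty]
    positivity
  -- `ρ_f(m) ≤ g ∑_{e ∣ g, e ∣ m} ρ_{f₀}(m/e)`
  have hpt : ∀ m ∈ Icc 1 ⌊Y⌋₊, (polyRootCountMod ![quad a b c] m : ℝ) ≤
      (g : ℝ) * ∑ e ∈ (Nat.divisors g).filter (fun e => e ∣ m), (polyRootCountMod ![f₀] (m / e) : ℝ) := by
    intro m hm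
    rw [Finset.mem_Icc] at hm
    have h1 := htrans m hm.1
    have hmem : Nat.gcd m g ∈ (Nat.divisors g).filter (fun e => e ∣ m) := by
      rw [Finset.mem_filter, Nat.mem_divisors]
      exact ⟨⟨Nat.gcd_dvd_right _ _, by omega⟩, Nat.gcd_dvd_left _ _⟩
    have h2 : (polyRootCountMod ![f₀] (m / Nat.gcd m g) : ℝ) ≤
        ∑ e ∈ (Nat.divisors g).filter (fun e => e ∣ m), (polyRootCountMod ![f₀] (m / e) : ℝ) :=
      Finset.single_le_sum (f := fun e => (polyRootCountMod ![f₀] (m / e) : ℝ))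
        (fun _ _ => Nat.cast_nonneg _) hmem
    have hgcd : (Nat.gcd m g : ℝ) ≤ g := by exact_mod_cast Nat.gcd_le_right _ (by omega)
    calc (polyRootCountMod ![quad a b c] m : ℝ)
        ≤ (Nat.gcd m g : ℝ) * (polyRootCountMod ![f₀] (m / Nat.gcd m g) : ℝ) := by exact_mod_cast h1
      _ ≤ (g : ℝ) * ∑ e ∈ (Nat.divisors g).filter (fun e => e ∣ m), (polyRootCountMod ![f₀] (m / e) : ℝ) :=
          mul_le_mul hgcd h2 (Nat.cast_nonneg _) (Nat.cast_nonneg _)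
  -- interchange and reindex `m = e m'`
  have hswap : ∑ m ∈ Icc 1 ⌊Y⌋₊, ∑ e ∈ (Nat.divisors g).filter (fun e => e ∣ m),
      (polyRootCountMod ![f₀] (m / e) : ℝ) =
      ∑ e ∈ Nat.divisors g, ∑ m ∈ (Icc 1 ⌊Y⌋₊).filter (fun m => e ∣ m),
        (polyRootCountMod ![f₀] (m / e) : ℝ) := by
    rw [Finset.sum_comm']
    intro m e
    simp only [Finset.mem_filter]
    tauto
  have hinner : ∀ e ∈ Nat.divisors g, ∑ m ∈ (Icc 1 ⌊Y⌋₊).filter (fun m => e ∣ m),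
      (polyRootCountMod ![f₀] (m / e) : ℝ) ≤ (C₀ + 1) * Y := by
    intro e he
    have he1 : 1 ≤ e := Nat.pos_of_mem_divisors he
    rw [sum_Icc_filter_dvd_eq he1 hY]
    have hsimp : ∀ m : ℕ, e * m / e = m := fun m => Nat.mul_div_cancel_left m (by omega)
    simp_rw [hsimp]
    rcases lt_or_ge (Y / e) 1 with hsmall | hbig
    · rw [Nat.floor_eq_zero.2 hsmall]
      simp only [show Icc 1 0 = ∅ by rfl, Finset.sum_empty]
      positivity
    · calc ∑ m ∈ Icc 1 ⌊Y / e⌋₊, (polyRootCountMod ![f₀] m : ℝ) ≤ (C₀ + 1) * (Y / e) := hmv' _ hbig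
        _ ≤ (C₀ + 1) * Y := by
            refine mul_le_mul_of_nonneg_left (div_le_self hY (by exact_mod_cast he1)) (by positivity)
  calc ∑ m ∈ Icc 1 ⌊Y⌋₊, (polyRootCountMod ![quad a b c] m : ℝ)
      ≤ ∑ m ∈ Icc 1 ⌊Y⌋₊, (g : ℝ) * ∑ e ∈ (Nat.divisors g).filter (fun e => e ∣ m),
          (polyRootCountMod ![f₀] (m / e) : ℝ) := Finset.sum_le_sum hpt
    _ = (g : ℝ) * ∑ e ∈ Nat.divisors g, ∑ m ∈ (Icc 1 ⌊Y⌋₊).filter (fun m => e ∣ m),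
          (polyRootCountMod ![f₀] (m / e) : ℝ) := by rw [← Finset.mul_sum, hswap]
    _ ≤ (g : ℝ) * ∑ e ∈ Nat.divisors g, (C₀ + 1) * Y :=
        mul_le_mul_of_nonneg_left (Finset.sum_le_sum hinner) (Nat.cast_nonneg _)
    _ = (g : ℝ) * ((Nat.divisors g).card * ((C₀ + 1) * Y)) := by rw [Finset.sum_const, nsmul_eq_mul]
    _ ≤ (g : ℝ) * (g * ((C₀ + 1) * Y)) := by
        gcongr
        exact_mod_cast Nat.card_divisors_le_self g
    _ = (g : ℝ) * ((g : ℝ) * (C₀ + 1)) * Y := by ring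
    _ ≤ ((g : ℝ) * ((g : ℝ) * (C₀ + 1)) + 1) * Y := by nlinarith

/-- **The error terms of §5** ("the condition `(m, n₁n₂) = 1` can be removed at the cost of two
error terms bounded trivially by `4 ∑_{m ≡ 0 (n_j)} g(m) ρ(m) ≪ N^{−1} M`, `j = 1, 2`, again taking
advantage of the fact that `n₁, n₂` are primes", p. 433): for DFI's `f` there is `C` with
`∑_{1 ≤ m ≤ X, p ∣ m} ρ_f(p q m) ≤ C X / p` for all primes `p ≠ q` and `X ≥ 0`.
[cite: DukeFriedlanderIwaniec1995, §5 p. 433] -/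
theorem exists_sum_rho_offdiag_le_quad {a b c : ℤ} (hD : 0 < a * c - b ^ 2) :
    ∃ C : ℝ, 0 < C ∧ ∀ p q : ℕ, p.Prime → q.Prime → p ≠ q → ∀ X : ℝ, 0 ≤ X →
      ∑ m ∈ (Icc 1 ⌊X⌋₊).filter (fun m : ℕ => p ∣ m),
        (polyRootCountMod ![quad a b c] (p * q * m) : ℝ) ≤ C * X / p := by
  obtain ⟨B, hB1, hB⟩ := exists_rho_primePow_le_quad hD
  obtain ⟨C₀, hC₀, hmv⟩ := exists_sum_rho_le_quad hD
  refine ⟨2 * B * (2 * B * C₀), by positivity, fun p q hp hq hpq X hX => ?_⟩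
  -- `∑_{m ≤ Y} ρ(q m) ≤ 2 B C₀ Y`
  have hq1 : ∀ Y : ℝ, 0 ≤ Y → ∑ m ∈ Icc 1 ⌊Y⌋₊, (polyRootCountMod ![quad a b c] (q * m) : ℝ) ≤
      2 * B * C₀ * Y := by
    intro Y hY
    have := sum_rho_primePow_mul_le hB hC₀.le hq (k := 1) (by simp [hq.one_lt.ne'])
      (fun Y hY => by simpa using hmv Y hY) 1 le_rfl Y hY
    simpa using this
  -- peel off `p`: `∑_{m' ≤ X/p} ρ(p² q m') ≤ 2B (2BC₀) (X/p)`
  have hpq' : ¬ p ∣ q := by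
    intro h
    exact hpq ((Nat.prime_dvd_prime_iff_eq hp hq).1 h)
  have hmain := sum_rho_primePow_mul_le hB (by positivity) hp hpq' hq1 2 (by norm_num) (X / p)
    (by positivity)
  rw [sum_Icc_filter_dvd_eq hp.one_lt.le hX]
  have hresc : ∀ m : ℕ, p * q * (p * m) = p ^ 2 * q * m := fun m => by ring
  simp_rw [hresc]
  calc ∑ m ∈ Icc 1 ⌊X / p⌋₊, (polyRootCountMod ![quad a b c] (p ^ 2 * q * m) : ℝ)
      ≤ 2 * B * (2 * B * C₀) * (X / p) := hmain
    _ = 2 * B * (2 * B * C₀) * X / p := by ring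

end DFI1995

end Literature.NumberTheory.Sieve
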